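import Summits.AtomisticToContinuum.Crystallization.Theorems.FrustratedLawDichotomySchurCut
import Summits.AtomisticToContinuum.Crystallization.Theorems.FrustratedLawDichotomySchurDomination

/-!
# FrustratedLawDichotomy · SCHUR CUT, part B (§4 literal data SF₄ / SF₄₅ / SF₅, §5 the crux BY NAME, §6 the Schur domination principle PROVED)

Continuation of `FrustratedLawDichotomySchurCut` (lens-5 g34 v4 sha256 e5cfb03ebb400ac3, 490 l; PRE-SPLIT by hand-2 g12 for the 400-line rule at the
§3/§4 boundary — bodies byte-identical, same namespace; see the module docstring of part A for the node).  Landed `--kind definition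
--supports stmt-AtomisticToContinuum-27623 --as helper` (critic row 497 landing instruction of record).
-/

noncomputable section

namespace Summit.AtomisticToContinuum.Crystallization.Theorems.FrustratedLawDichotomySchurCut

open scoped BigOperators
open MeasureTheory
open Literature.MathematicalPhysics.StatisticalMechanics (interactionEnergy lennardJones PeriodicConfiguration)
open Summit.AtomisticToContinuum.Crystallization.Theorems.ChargedEnergyGapNegative (E3 eStar eStar_le)
open Summit.AtomisticToContinuum.Crystallization.Theorems.FrustratedLawDichotomyRangeCut

/-! ## §4. Literal data: the two certified instances (ranges 4 and 5) -/

/-- Tail weight of the **range-4 instance**: cubic smoothstep across `[5/2, 4]`. -/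
def w₄ (r : ℝ) : ℝ := cutWeight smoothstep₁ (5 / 2) 4 r

/-- Overlap kernel of the range-4 instance: bump radius `a = 4/5` (`ω(r) = omega₂(5r/4)`, support `8/5`). -/
def ω₄ (r : ℝ) : ℝ := omega₂ (5 * r / 4)

/-- Tail weight of the **range-5 instance**: quintic smoothstep across `[3, 5]`. -/
def w₅ (r : ℝ) : ℝ := cutWeight smoothstep₂ 3 5 r

/-- Overlap kernel of the range-5 instance: bump radius `a = 1` (`ω = omega₂`, support `2`). -/
def ω₅ (r : ℝ) : ℝ := omega₂ r

/-- **SF₄ = `SchurFloor w₄ ω₄ (29/2500)`** — certified numerically (dominator `K` on a `0.02` grid, `‖K‖₁ = 0.02346` incl. safety ×1.003,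
`A = ½‖K‖₁·k₂(0)`, `k₂(0) = 35/(22π(4/5)³)`; scripts/validate.py I4).  Slack at `fcc⋆/hcp⋆`: `1.68·10⁻³ / 1.64·10⁻³` per site. -/
def SF₄ : Prop := SchurFloor w₄ ω₄ (29 / 2500)

/-- **SF₅ = `SchurFloor w₅ ω₅ (13/4000)`** — KNOWN-type with a COMPLETE ELEMENTARY DERIVATION (NODE-g34.md §3): bump `β = (1 − |x|²)₊²`
(`k₂(0) = 35/(22π)` exactly), CLOSED-FORM dominator `K(r) = (r⁻⁶/6)·smoothstep₁((r − 18/5)/(2/5))`, `‖K‖₁ = 0.0127653` (an elementary integral),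
`A = (35/(44π))‖K‖₁ = 0.0032322 ≤ 13/4000`; domination `(k₂∗K) ≥ |V·w₅|`: EXACT for `r ≥ 6` (spherical means of the subharmonic `r⁻⁶`), and on
`[3, 6]` a one-variable inequality between elementary functions holding with margin `≥ 3.56 %` (fine grid `0.005`, scripts/closed_form_final.py;
interval-arithmetic certificate = census ask).  Slack at `fcc⋆/hcp⋆/sheared hcp`: `1.063 / 1.069 / 1.065·10⁻³` per site (the LP-optimal dominator
would give `8.1·10⁻⁴` at `A = 19/6000`). -/
def SF₅ : Prop := SchurFloor w₅ ω₅ (13 / 4000)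

/-- Tail weight of the **range-9/2 instance**: cubic smoothstep across `[3, 9/2]` (overlap kernel `ω₄`, bump radius `4/5`). -/
def w₄₅ (r : ℝ) : ℝ := cutWeight smoothstep₁ 3 (9 / 2) r

/-- **SF₄₅ = `SchurFloor w₄₅ ω₄ (3/400)`** — KNOWN-type with the same complete elementary derivation as `SF₅` (NODE-g34.md §3bis): bump radius
`a = 4/5` (`k₂(0) = 35/(22π)·(5/4)³`), CLOSED-FORM dominator `K(r) = (r⁻⁶/6)·smoothstep₁((r − 33/10)/(3/5))`, `‖K‖₁ = 0.0150890`,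
`A = ½‖K‖₁k₂(0) = 0.0074620 ≤ 3/400`; domination exact for `r ≥ 11/2`, margin `≥ 2.19 %` on `[3, 11/2]` (closed_form_final45.py).  Slack at
`fcc⋆/hcp⋆/sheared hcp`: `1.107 / 1.150 / 1.146·10⁻³` per site; the effective potential has RANGE 9/2. -/
def SF₄₅ : Prop := SchurFloor w₄₅ ω₄ (3 / 400)

/-- Below the window the tail weight vanishes (range 5 instance). [folklore] -/
theorem w₅_eq_zero {r : ℝ} (h : r ≤ 3) : w₅ r = 0 := by
  have hx : (r - 3) / (5 - 3) ≤ 0 := div_nonpos_of_nonpos_of_nonneg (by linarith) (by norm_num)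
  simp [w₅, cutWeight, smoothstep₂, hx]

/-- Above the window the tail weight is one (range 5 instance). [folklore] -/
theorem w₅_eq_one {r : ℝ} (h : 5 ≤ r) : w₅ r = 1 := by
  have hx : 1 ≤ (r - 3) / (5 - 3) := by rw [le_div_iff₀ (by norm_num : (0:ℝ) < 5 - 3)]; linarith
  have hx' : ¬ (r - 3) / (5 - 3) ≤ 0 := by linarith
  simp [w₅, cutWeight, smoothstep₂, hx, hx']

/-- **`W₅` HAS RANGE 5**: `effPot w₅ ω₅ A r = 0` for `r ≥ 5`. [folklore] -/
theorem effPot_five_eq_zero (A : ℝ) {r : ℝ} (h : 5 ≤ r) : effPot w₅ ω₅ A r = 0 := by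
  have hω : ω₅ r = 0 := omega₂_of_two_le (by linarith)
  simp [effPot, corePot, w₅_eq_one h, hω]

/-- Inside `[2, 3]` the effective potential is Lennard-Jones itself (`w₅ = 0`, `ω₅ = 0`). [folklore] -/
theorem effPot_five_eq_lennardJones (A : ℝ) {r : ℝ} (h2 : 2 ≤ r) (h3 : r ≤ 3) : effPot w₅ ω₅ A r = lennardJones r := by
  have hω : ω₅ r = 0 := omega₂_of_two_le h2
  simp [effPot, corePot, w₅_eq_zero h3, hω]

/-- Above the window the tail weight is one (range 4 instance). [folklore] -/
theorem w₄_eq_one {r : ℝ} (h : 4 ≤ r) : w₄ r = 1 := by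
  have hx : 1 ≤ (r - 5 / 2) / (4 - 5 / 2) := by rw [le_div_iff₀ (by norm_num : (0:ℝ) < 4 - 5 / 2)]; linarith
  have hx' : ¬ (r - 5 / 2) / (4 - 5 / 2) ≤ 0 := by linarith
  simp [w₄, cutWeight, smoothstep₁, hx, hx']

/-- **`W₄` HAS RANGE 4**: `effPot w₄ ω₄ A r = 0` for `r ≥ 4`. [folklore] -/
theorem effPot_four_eq_zero (A : ℝ) {r : ℝ} (h : 4 ≤ r) : effPot w₄ ω₄ A r = 0 := by
  have hω : ω₄ r = 0 := omega₂_of_two_le (by linarith)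
  simp [effPot, corePot, w₄_eq_one h, hω]

/-- Above the window the tail weight is one (range 9/2 instance). [folklore] -/
theorem w₄₅_eq_one {r : ℝ} (h : 9 / 2 ≤ r) : w₄₅ r = 1 := by
  have hx : 1 ≤ (r - 3) / (9 / 2 - 3) := by rw [le_div_iff₀ (by norm_num : (0:ℝ) < 9 / 2 - 3)]; linarith
  have hx' : ¬ (r - 3) / (9 / 2 - 3) ≤ 0 := by linarith
  simp [w₄₅, cutWeight, smoothstep₁, hx, hx']

/-- **`W₄₅` HAS RANGE 9/2**: `effPot w₄₅ ω₄ A r = 0` for `r ≥ 9/2`. [folklore] -/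
theorem effPot_fourHalf_eq_zero (A : ℝ) {r : ℝ} (h : 9 / 2 ≤ r) : effPot w₄₅ ω₄ A r = 0 := by
  have hω : ω₄ r = 0 := omega₂_of_two_le (by linarith)
  simp [effPot, corePot, w₄₅_eq_one h, hω]

/-- **FDG ⟸ SF₄ ∧ UP(−0.7175) ∧ FRG♭₄(e₁ = −0.7174, C)** — the unsplit cut at RANGE 4 (strained-adversary margin ×1.97, MEASURED). [folklore] -/
theorem fdg_of_schurCut_four {C : ℝ} (hF : SF₄) (hU : PeriodicEnergyCeiling (-(7175 / 10000)))
    (hG : SchurRangeGap w₄ ω₄ (29 / 2500) (-(7174 / 10000)) C) : FDG :=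
  fdg_of_schurCut hF hU hG (by norm_num)

/-- **FDG ⟸ SF₅ ∧ UP(−0.7175) ∧ FRG♭₅(e₁ = −0.7174, C)** — the unsplit cut at RANGE 5 (margin ×2.86, MEASURED). [folklore] -/
theorem fdg_of_schurCut_five {C : ℝ} (hF : SF₅) (hU : PeriodicEnergyCeiling (-(7175 / 10000)))
    (hG : SchurRangeGap w₅ ω₅ (13 / 4000) (-(7174 / 10000)) C) : FDG :=
  fdg_of_schurCut hF hU hG (by norm_num)

/-- **FDG ⟸ SF₅ ∧ UP(−0.7175) ∧ T′♭₅(1/20, 1/8; κ_T = 1/100, C_T) ∧ E′♭₅(1/20, 1/8; κ_E = 1/1000, C_E, D_E)** — the FULLY FINITE-RANGE split at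
range 5 (rooms: `κ_T ≤ 1.51·10⁻²`, `κ_E ≤ 2.44·10⁻³`, MEASURED). [folklore] -/
theorem fdg_of_split_schurCut_five {CT CE DE : ℝ} (hF : SF₅) (hU : PeriodicEnergyCeiling (-(7175 / 10000)))
    (hT : SchurTopologicalPricing (1 / 20) (1 / 8) w₅ ω₅ (13 / 4000) (-(7175 / 10000)) (1 / 100) CT)
    (hE : SchurElasticPricing (1 / 20) (1 / 8) w₅ ω₅ (13 / 4000) (-(7175 / 10000)) (1 / 1000) CE DE) : FDG :=
  fdg_of_split_schurCut (by norm_num) hF hU (by norm_num) hT (by norm_num) hE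

/-- **FDG ⟸ SF₄ ∧ UP(−0.7175) ∧ T′♭₄(κ_T = 1/100) ∧ E′♭₄(κ_E = 1/1000)** — the fully finite-range split at RANGE 4 (rooms `1.45·10⁻²`,
`1.87·10⁻³`, MEASURED). [folklore] -/
theorem fdg_of_split_schurCut_four {CT CE DE : ℝ} (hF : SF₄) (hU : PeriodicEnergyCeiling (-(7175 / 10000)))
    (hT : SchurTopologicalPricing (1 / 20) (1 / 8) w₄ ω₄ (29 / 2500) (-(7175 / 10000)) (1 / 100) CT)
    (hE : SchurElasticPricing (1 / 20) (1 / 8) w₄ ω₄ (29 / 2500) (-(7175 / 10000)) (1 / 1000) CE DE) : FDG :=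
  fdg_of_split_schurCut (by norm_num) hF hU (by norm_num) hT (by norm_num) hE

/-- **FDG ⟸ E′(1/20, 1/8) ∧ SF₅ ∧ UP(−0.7175) ∧ T′♭₅(κ_T = 1/100, C_T)** — the REPAIRED form of generation 33's split range cut (its
`fdg_of_split_rangeCut_five` over the one-body floor is FALSE-type-indicated, ERRATUM above; over SF₅ the strained adversary passes ×3.3). [folklore] -/
theorem fdg_of_elastic_of_schurCut_five {CT : ℝ} (hE : ElasticPricing (1 / 20) (1 / 8)) (hF : SF₅)
    (hU : PeriodicEnergyCeiling (-(7175 / 10000)))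
    (hT : SchurTopologicalPricing (1 / 20) (1 / 8) w₅ ω₅ (13 / 4000) (-(7175 / 10000)) (1 / 100) CT) : FDG :=
  fdg_of_elastic_of_schurCut (by norm_num) hE hF hU (by norm_num) hT

/-- **FDG ⟸ SF₄₅ ∧ UP(−0.7175) ∧ FRG♭₄₅(e₁ = −0.7174, C)** — the unsplit cut at RANGE 9/2 with the closed-form floor (margin ×2.69, MEASURED).
[folklore] -/
theorem fdg_of_schurCut_fourHalf {C : ℝ} (hF : SF₄₅) (hU : PeriodicEnergyCeiling (-(7175 / 10000)))
    (hG : SchurRangeGap w₄₅ ω₄ (3 / 400) (-(7174 / 10000)) C) : FDG :=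
  fdg_of_schurCut hF hU hG (by norm_num)

/-- **FDG ⟸ SF₄₅ ∧ UP(−0.7175) ∧ T′♭₄₅(κ_T = 1/100) ∧ E′♭₄₅(κ_E = 1/1000)** — the fully finite-range split at RANGE 9/2 (rooms `1.50·10⁻²`,
`2.36·10⁻³`, MEASURED). [folklore] -/
theorem fdg_of_split_schurCut_fourHalf {CT CE DE : ℝ} (hF : SF₄₅) (hU : PeriodicEnergyCeiling (-(7175 / 10000)))
    (hT : SchurTopologicalPricing (1 / 20) (1 / 8) w₄₅ ω₄ (3 / 400) (-(7175 / 10000)) (1 / 100) CT)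
    (hE : SchurElasticPricing (1 / 20) (1 / 8) w₄₅ ω₄ (3 / 400) (-(7175 / 10000)) (1 / 1000) CE DE) : FDG :=
  fdg_of_split_schurCut (by norm_num) hF hU (by norm_num) hT (by norm_num) hE

/-! ## §5. The crux and its sibling BY NAME -/

/-- **THE NODE, crux form (unsplit)**: `MuEquilibriumDoor ∧ SF ∧ UP(eUp) ∧ FRG♭(e₁, C) ∧ (eUp < e₁) ⟹ AperiodicFrustratedLawGap`. [folklore] -/
theorem aperiodicFrustratedLawGap_of_schurCut {w ω : ℝ → ℝ} {A eUp e₁ C : ℝ}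
    (hDoor : Summit.AtomisticToContinuum.Crystallization.Theses.GrainCoreNetworkSplit.MuEquilibriumDoor)
    (hF : SchurFloor w ω A) (hU : PeriodicEnergyCeiling eUp) (hG : SchurRangeGap w ω A e₁ C) (he : eUp < e₁) :
    Summit.AtomisticToContinuum.Crystallization.Theses.FrustratedLawDichotomy.AperiodicFrustratedLawGap :=
  aperiodicFrustratedLawGap_of_fdg hDoor (fdg_of_schurCut hF hU hG he)

/-- **THE NODE, crux form (fully finite-range split)**:
`MuEquilibriumDoor ∧ SF ∧ UP(eUp) ∧ T′♭(1/20, η₁; κ_T > 0) ∧ E′♭(1/20, η₁; κ_E > 0) ⟹ AperiodicFrustratedLawGap`. [folklore] -/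
theorem aperiodicFrustratedLawGap_of_split_schurCut {η₁ : ℝ} {w ω : ℝ → ℝ} {A eUp κT CT κE CE DE : ℝ} (h01 : (1 : ℝ) / 20 ≤ η₁)
    (hDoor : Summit.AtomisticToContinuum.Crystallization.Theses.GrainCoreNetworkSplit.MuEquilibriumDoor)
    (hF : SchurFloor w ω A) (hU : PeriodicEnergyCeiling eUp)
    (hκT : 0 < κT) (hT : SchurTopologicalPricing (1 / 20) η₁ w ω A eUp κT CT)
    (hκE : 0 < κE) (hE : SchurElasticPricing (1 / 20) η₁ w ω A eUp κE CE DE) :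
    Summit.AtomisticToContinuum.Crystallization.Theses.FrustratedLawDichotomy.AperiodicFrustratedLawGap :=
  aperiodicFrustratedLawGap_of_fdg hDoor (fdg_of_split_schurCut h01 hF hU hκT hT hκE hE)

/-- **The literal node at range 5**: `MuEquilibriumDoor ∧ SF₅ ∧ UP(−0.7175) ∧ FRG♭₅(−0.7174, C) ⟹ AperiodicFrustratedLawGap`. [folklore] -/
theorem aperiodicFrustratedLawGap_of_schurCut_five {C : ℝ}
    (hDoor : Summit.AtomisticToContinuum.Crystallization.Theses.GrainCoreNetworkSplit.MuEquilibriumDoor)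
    (hF : SF₅) (hU : PeriodicEnergyCeiling (-(7175 / 10000))) (hG : SchurRangeGap w₅ ω₅ (13 / 4000) (-(7174 / 10000)) C) :
    Summit.AtomisticToContinuum.Crystallization.Theses.FrustratedLawDichotomy.AperiodicFrustratedLawGap :=
  aperiodicFrustratedLawGap_of_fdg hDoor (fdg_of_schurCut_five hF hU hG)

/-- **The literal node at range 4**: `MuEquilibriumDoor ∧ SF₄ ∧ UP(−0.7175) ∧ FRG♭₄(−0.7174, C) ⟹ AperiodicFrustratedLawGap`. [folklore] -/
theorem aperiodicFrustratedLawGap_of_schurCut_four {C : ℝ}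
    (hDoor : Summit.AtomisticToContinuum.Crystallization.Theses.GrainCoreNetworkSplit.MuEquilibriumDoor)
    (hF : SF₄) (hU : PeriodicEnergyCeiling (-(7175 / 10000))) (hG : SchurRangeGap w₄ ω₄ (29 / 2500) (-(7174 / 10000)) C) :
    Summit.AtomisticToContinuum.Crystallization.Theses.FrustratedLawDichotomy.AperiodicFrustratedLawGap :=
  aperiodicFrustratedLawGap_of_fdg hDoor (fdg_of_schurCut_four hF hU hG)

/-- **The literal fully finite-range split at range 5, crux form.** [folklore] -/
theorem aperiodicFrustratedLawGap_of_split_schurCut_five {CT CE DE : ℝ}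
    (hDoor : Summit.AtomisticToContinuum.Crystallization.Theses.GrainCoreNetworkSplit.MuEquilibriumDoor)
    (hF : SF₅) (hU : PeriodicEnergyCeiling (-(7175 / 10000)))
    (hT : SchurTopologicalPricing (1 / 20) (1 / 8) w₅ ω₅ (13 / 4000) (-(7175 / 10000)) (1 / 100) CT)
    (hE : SchurElasticPricing (1 / 20) (1 / 8) w₅ ω₅ (13 / 4000) (-(7175 / 10000)) (1 / 1000) CE DE) :
    Summit.AtomisticToContinuum.Crystallization.Theses.FrustratedLawDichotomy.AperiodicFrustratedLawGap :=
  aperiodicFrustratedLawGap_of_fdg hDoor (fdg_of_split_schurCut_five hF hU hT hE)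

/-- **The literal node at range 9/2 (closed-form floor)**: `MuEquilibriumDoor ∧ SF₄₅ ∧ UP(−0.7175) ∧ FRG♭₄₅(−0.7174, C) ⟹ AperiodicFrustratedLawGap`.
[folklore] -/
theorem aperiodicFrustratedLawGap_of_schurCut_fourHalf {C : ℝ}
    (hDoor : Summit.AtomisticToContinuum.Crystallization.Theses.GrainCoreNetworkSplit.MuEquilibriumDoor)
    (hF : SF₄₅) (hU : PeriodicEnergyCeiling (-(7175 / 10000))) (hG : SchurRangeGap w₄₅ ω₄ (3 / 400) (-(7174 / 10000)) C) :
    Summit.AtomisticToContinuum.Crystallization.Theses.FrustratedLawDichotomy.AperiodicFrustratedLawGap :=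
  aperiodicFrustratedLawGap_of_fdg hDoor (fdg_of_schurCut_fourHalf hF hU hG)

/-- **The sibling `PeriodicFrustratedLawGap` (item 27624) from the same pieces.** [folklore] -/
theorem periodicFrustratedLawGap_of_schurCut {w ω : ℝ → ℝ} {A eUp e₁ C : ℝ}
    (hDoor : Summit.AtomisticToContinuum.Crystallization.Theses.GrainCoreNetworkSplit.MuEquilibriumDoor)
    (hF : SchurFloor w ω A) (hU : PeriodicEnergyCeiling eUp) (hG : SchurRangeGap w ω A e₁ C) (he : eUp < e₁) :
    Summit.AtomisticToContinuum.Crystallization.Theses.FrustratedLawDichotomy.PeriodicFrustratedLawGap :=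
  periodicFrustratedLawGap_of_fdg hDoor (fdg_of_schurCut hF hU hG he)

/-! ## §6. Beneath SF: the abstract Schur domination principle — PROVED (hand-1 g12, `FrustratedLawDichotomySchurDomination`) -/

/-- **SCHUR DOMINATION** (the analysis behind every `SchurFloor` instance · KNOWN-type — folklore: Schur test / Bochner positivity of
autocorrelations — · PROVED below from the tree theorem `FrustratedLawDichotomySchurDomination.schurDomination`, hand-1 g12): for a
NONNEGATIVE continuous compactly supported `β`, a nonnegative EVEN integrable `K` and any `φ` with `−φ ≤ (β ⋆ β) ∗ K` pointwise, every finite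
family of points satisfies `Σ_{i<j} φ(yᵢ − yⱼ) ≥ −½‖K‖₁·(N·(β⋆β)(0) + 2·Σ_{i<j} (β⋆β)(yᵢ − yⱼ))`
(proof: `(β⋆β)∗K` is even because `K` is, so `Σ_{i<j} = ½(Σ_{i,j} − N·((β⋆β)∗K)(0))`; `Σ_{i,j}((β⋆β)∗K)(yᵢ−yⱼ) = ∫ K(u)·⟨F, F(·−u)⟩ du ≤
‖K‖₁‖F‖₂²`, `F = Σᵢ β(·−yᵢ)`; the diagonal `N·((β⋆β)∗K)(0)` is nonnegative because `β ≥ 0`, `K ≥ 0`, and is dropped).  `β ≥ 0` and `K` even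
are NECESSARY (hand-1 g12, bus 2026-08-31T15:38Z: for sign-changing `β` or non-even `K` the inequality fails already at `N = 2`; the first
typing of this def lacked both and mis-parenthesised `N·∫β²`).  `SchurFloor w ω A` is its radial instance `β = (1 − |x|²/a²)₊² ≥ 0`, `K` radial
(hence even), `φ(z) = (V·w)(|z|)`, `ω = (β⋆β)/(β⋆β)(0)`, `A = ½‖K‖₁(β⋆β)(0)` with a certified dominator `K`; what remains for `SF₅`/`SF₄₅` as
theorems is the radial bookkeeping (`ω₅ = (β⋆β)/(β⋆β)(0)` for this `β`, `(β⋆β)(0) = 32πa³/315`) and the one-variable near-field certificate. -/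
def SchurDomination : Prop :=
  ∀ (β K φ : EuclideanSpace ℝ (Fin 3) → ℝ), Continuous β → HasCompactSupport β → (∀ x, 0 ≤ β x) →
    (∀ u, 0 ≤ K u) → Integrable K → (∀ u, K (-u) = K u) →
    (∀ z, -φ z ≤ ∫ u, K u * ∫ x, β x * β (x - (z - u))) →
    ∀ (N : ℕ) (y : Fin N → EuclideanSpace ℝ (Fin 3)),
      -((∫ u, K u) / 2 * ((N : ℝ) * (∫ x, β x ^ 2) + 2 * ∑ i, ∑ j ∈ Finset.Ioi i, ∫ x, β x * β (x - (y i - y j)))) ≤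
        ∑ i, ∑ j ∈ Finset.Ioi i, φ (y i - y j)

/-- `SchurDomination` HOLDS — by hand-1 g12's tree theorem `schurDomination` (Theorems/FrustratedLawDichotomySchurDomination.lean). [folklore] -/
theorem schurDomination_holds : SchurDomination :=
  fun β K φ hβc hβs hβ0 hK0 hKi hKev hdom N y =>
    FrustratedLawDichotomySchurDomination.schurDomination β K φ hβc hβs hβ0 hK0 hKi hKev hdom N y

end Summit.AtomisticToContinuum.Crystallization.Theorems.FrustratedLawDichotomySchurCut

end
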